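import Mathlib
import HarnessLib
import Summits.AtomisticToContinuum.FouriersLaw.Theses.JunctionLocality
import Summits.AtomisticToContinuum.FouriersLaw.Theorems.JunctionLocalitySuperadditiveResistanceStubInsertionIdentity
import Summits.AtomisticToContinuum.FouriersLaw.Theorems.JunctionLocalitySuperadditiveResistanceStubKuboFrameResolventBound
import Summits.AtomisticToContinuum.FouriersLaw.Theorems.JunctionLocalitySuperadditiveResistanceStubDeviceForwardFieldsAux6

/-!
# The weak Abelian limit `κ g_κ ⇀ 0` of the device's resolvent fields
(helper `helper_resolventWeakAbelian` toward stub `stub_kuboFrame`, line `thermalise-then-cut-probe-insertion`,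
crux stmt-AtomisticToContinuum-11748, skeleton v3.1; `--supports` stmt-AtomisticToContinuum-11748)

Device: the `(N+M)`-chain `pinnedChain ω₂ lam β γ` with two extra friction-`γ` thermostats on `p_{N−1}, p_N`, all
terminals at `T`; `L_dev = X_H + γ S_B`, `B = deviceWeight N M` (landed `deviceGenerator_eq`), Gibbs state `μ_T`. For
κ-resolvent fields `g_κ ∈ C² ∩ L²(μ_T)`, `κ g_κ − L_dev g_κ = k := p_s² − T` (`κ > 0`, landed
`exists_deviceResolventField`): `κ ⟨g_κ, φ⟩_{L²(μ_T)} → 0` as `κ → 0⁺` for EVERY `φ ∈ L²(μ_T)` (`κ g_κ ⇀ 0`).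
Proof (no semigroup, no compactness): uniform bound `‖κ g_κ‖ ≤ √2 T` (landed helper (B)
`helper_resolventUniformBound`); on constants `κ ∫ g_κ dμ_T = ∫ k dμ_T = 0` (the source of an exact pair has mean
zero: landed `Kubo.cross` against the constant pair `(1, 0)`); on the adjoint range `ψ = −X_H f + γ S_B f`,
`f ∈ C_c^∞`: `κ⟨g_κ, ψ⟩ = κ²⟨g_κ, f⟩ − κ⟨k, f⟩ → 0` (landed `integral_genOp_mul_eq_adjoint`); DENSITY of
`ℝ·1 + L_dev^†(C_c^∞)`: an orthogonal vector is a mean-zero weak `L²` solution of `L_dev v = 0`, smooth by the landed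
`exists_classical_of_weak_gibbs` (Hörmander) and zero by the landed Liouville theorem `eq_zero_of_liouville_pinnedChain`;
then `ε/2`. No definitions; standard axioms. References: folklore (mean ergodic theorem, Abelian form).
-/

noncomputable section

open MeasureTheory Filter Topology ProbabilityTheory
open scoped ContDiff NNReal InnerProductSpace
open Literature.MathematicalPhysics.KineticTheory.HeatConduction

namespace Summit.AtomisticToContinuum.FouriersLaw.Cruxes.SuperadditiveResistance.ThermaliseThenCutProbeInsertion

open Summit.AtomisticToContinuum.FouriersLaw.Theorems.SuperadditiveResistance
open Summit.AtomisticToContinuum.FouriersLaw.Theorems.SuperadditiveResistance.Kubo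
  (cross memLp_kinetic integral_kinetic_mul_gibbsDensity integrable_mul_mul_gibbsDensity
    integrable_mul_gibbsDensity_iff)
open Summit.AtomisticToContinuum.FouriersLaw.Theorems.SuperadditiveResistance.DeviceLiouville
  (liouvilleOp bathOp deviceWeight deviceGenerator_eq kin_eq_sq eq_zero_of_liouville_pinnedChain)
open Summit.AtomisticToContinuum.FouriersLaw.Cruxes.SuperadditiveResistance.FloatingProbeBypassLaplacian
  (exists_classical_of_weak_gibbs integral_genOp_mul_eq_adjoint inner_toLp_left inner_toLp_toLp norm_toLp_sq
    memLp_two_of_hasCompactSupport continuous_genOp hasCompactSupport_genOp)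

section General

variable {ω₂ lam β γ : ℝ} {L : ℕ}

/-- `σ X_H a + c S_B a = 0` on a constant `a`. -/
theorem genOp_const_fun (P : OscillatorChain) (L : ℕ) (σ c : ℝ) (B : Fin L → ℝ) (T a : ℝ)
    (x : PhaseSpace L) :
    σ * liouvilleOp P L (fun _ => a) x + c * bathOp L B T (fun _ => a) x = 0 := by
  have h1 : ∀ i : Fin L, partialP i (fun _ : PhaseSpace L => a) = fun _ => 0 :=
    fun i => funext fun y => partialP_const a i y
  have h2 : ∀ (i : Fin L) (y : PhaseSpace L), partialQ i (fun _ : PhaseSpace L => a) y = 0 :=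
    fun i y => partialQ_const a i y
  simp [DeviceLiouville.liouvilleOp, DeviceLiouville.bathOp, h1, h2]

/-- **The source of an exact pair has mean zero**: for `f ∈ C² ∩ L²(μ_T)`, `k ∈ L²(μ_T)` with
`σ X_H f + c S_B f = −k` (`B ≥ 0`, `c > 0`): `∫ k e^{−H/T} = 0` (cross Green identity against the constant
`(−σ)`-pair `(1, 0)`). -/
theorem integral_source_mul_gibbsDensity_eq_zero (hω : 0 < ω₂) (hl : 0 ≤ lam) (hβ : 0 ≤ β) (L : ℕ) {T : ℝ}
    (hT : 0 < T) (B : Fin L → ℝ) (hB : ∀ i, 0 ≤ B i) (σ : ℝ) {c : ℝ} (hc : 0 < c)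
    {f k : PhaseSpace L → ℝ} (hf : ContDiff ℝ 2 f) (hf2 : MemLp f 2 ((pinnedChain ω₂ lam β γ).gibbsMeasure L T))
    (hk2 : MemLp k 2 ((pinnedChain ω₂ lam β γ).gibbsMeasure L T))
    (hpde : ∀ x, σ * liouvilleOp (pinnedChain ω₂ lam β γ) L f x + c * bathOp L B T f x = -k x) :
    ∫ x, k x * (pinnedChain ω₂ lam β γ).gibbsDensity L T x = 0 := by
  haveI : IsProbabilityMeasure ((pinnedChain ω₂ lam β γ).gibbsMeasure L T) :=
    pinnedChain_isProbabilityMeasure_gibbsMeasure hω hl hβ γ L hT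
  have hph : ∀ x, -σ * liouvilleOp (pinnedChain ω₂ lam β γ) L (fun _ => (1 : ℝ)) x +
      c * bathOp L B T (fun _ => (1 : ℝ)) x = -(fun _ : PhaseSpace L => (0 : ℝ)) x := by
    intro x
    rw [genOp_const_fun]
    simp
  have h := cross hω hl hβ L hT B hB σ hc hf contDiff_const hf2 (memLp_const 1) hk2 (memLp_const 0) hpde hph
  simpa using h

/-- **Mean of a resolvent field**: for `σ X_H g + c S_B g = −(k − κ g)` (`g ∈ C² ∩ L²(μ_T)`, `k ∈ L²(μ_T)`):
`κ ∫ g e^{−H/T} = ∫ k e^{−H/T}`. -/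
theorem integral_resolvent_mul_gibbsDensity (hω : 0 < ω₂) (hl : 0 ≤ lam) (hβ : 0 ≤ β) (L : ℕ) {T : ℝ}
    (hT : 0 < T) (B : Fin L → ℝ) (hB : ∀ i, 0 ≤ B i) (σ : ℝ) {c : ℝ} (hc : 0 < c) (κ : ℝ)
    {g k : PhaseSpace L → ℝ} (hg : ContDiff ℝ 2 g) (hg2 : MemLp g 2 ((pinnedChain ω₂ lam β γ).gibbsMeasure L T))
    (hk2 : MemLp k 2 ((pinnedChain ω₂ lam β γ).gibbsMeasure L T))
    (hpde : ∀ x, σ * liouvilleOp (pinnedChain ω₂ lam β γ) L g x + c * bathOp L B T g x = -(k x - κ * g x)) :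
    κ * ∫ x, g x * (pinnedChain ω₂ lam β γ).gibbsDensity L T x =
      ∫ x, k x * (pinnedChain ω₂ lam β γ).gibbsDensity L T x := by
  haveI : IsProbabilityMeasure ((pinnedChain ω₂ lam β γ).gibbsMeasure L T) :=
    pinnedChain_isProbabilityMeasure_gibbsMeasure hω hl hβ γ L hT
  have h : ∫ x, (k x - κ * g x) * (pinnedChain ω₂ lam β γ).gibbsDensity L T x = 0 :=
    integral_source_mul_gibbsDensity_eq_zero hω hl hβ L hT B hB σ hc hg hg2 (k := fun y => k y - κ * g y)
      (hk2.sub (hg2.const_mul κ)) hpde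
  have hIk : Integrable (fun x => k x * (pinnedChain ω₂ lam β γ).gibbsDensity L T x) :=
    (integrable_mul_gibbsDensity_iff hω hl hβ γ L hT k).2 (hk2.integrable one_le_two)
  have hIg : Integrable (fun x => g x * (pinnedChain ω₂ lam β γ).gibbsDensity L T x) :=
    (integrable_mul_gibbsDensity_iff hω hl hβ γ L hT g).2 (hg2.integrable one_le_two)
  have e : ∫ x, (k x - κ * g x) * (pinnedChain ω₂ lam β γ).gibbsDensity L T x =
      ∫ x, (k x * (pinnedChain ω₂ lam β γ).gibbsDensity L T x -
        κ * (g x * (pinnedChain ω₂ lam β γ).gibbsDensity L T x)) :=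
    integral_congr_ae (ae_of_all _ fun x => by ring)
  rw [e, integral_sub hIk (hIg.const_mul κ), integral_const_mul] at h
  linarith

/-- **Adjoint pairing of a resolvent field with a test function**: for `f ∈ C²_c`, `g ∈ C² ∩ L²(μ_T)` with
`σ X_H g + c S_B g = −(k − κ g)`, `k ∈ L²(μ_T)`:
`∫ (−σ X_H f + c S_B f) g dμ_T = κ ∫ f g dμ_T − ∫ f k dμ_T` (the `μ_T`-adjoint of `σ X_H + c S_B` is
`−σ X_H + c S_B`). -/
theorem integral_adjointOp_mul_resolvent (hω : 0 < ω₂) (hl : 0 ≤ lam) (hβ : 0 ≤ β) (L : ℕ) {T : ℝ}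
    (hT : 0 < T) (B : Fin L → ℝ) (σ c κ : ℝ) {f g k : PhaseSpace L → ℝ} (hf : ContDiff ℝ 2 f)
    (hfc : HasCompactSupport f) (hg : ContDiff ℝ 2 g) (hg2 : MemLp g 2 ((pinnedChain ω₂ lam β γ).gibbsMeasure L T))
    (hk2 : MemLp k 2 ((pinnedChain ω₂ lam β γ).gibbsMeasure L T))
    (hpde : ∀ x, σ * liouvilleOp (pinnedChain ω₂ lam β γ) L g x + c * bathOp L B T g x = -(k x - κ * g x)) :
    ∫ x, (-σ * liouvilleOp (pinnedChain ω₂ lam β γ) L f x + c * bathOp L B T f x + 0 * f x) * g x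
        ∂((pinnedChain ω₂ lam β γ).gibbsMeasure L T) =
      κ * ∫ x, f x * g x ∂((pinnedChain ω₂ lam β γ).gibbsMeasure L T) -
        ∫ x, f x * k x ∂((pinnedChain ω₂ lam β γ).gibbsMeasure L T) := by
  haveI : IsProbabilityMeasure ((pinnedChain ω₂ lam β γ).gibbsMeasure L T) :=
    pinnedChain_isProbabilityMeasure_gibbsMeasure hω hl hβ γ L hT
  have hU1 : ContDiff ℝ 1 (pinnedChain ω₂ lam β γ).U := pinnedChain_contDiff_U ω₂ lam β γ
  have hV1 : ContDiff ℝ 1 (pinnedChain ω₂ lam β γ).V := pinnedChain_contDiff_V ω₂ lam β γ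
  have hf2 : MemLp f 2 ((pinnedChain ω₂ lam β γ).gibbsMeasure L T) :=
    memLp_two_of_hasCompactSupport _ hf.continuous hfc
  have hadj := integral_genOp_mul_eq_adjoint (pinnedChain ω₂ lam β γ) hU1 hV1 L hT.ne' (-σ) c B 0 hf hfc hg
  have hpt : ∀ x, -(-σ) * liouvilleOp (pinnedChain ω₂ lam β γ) L g x + c * bathOp L B T g x + 0 * g x =
      κ * g x - k x := fun x => by linear_combination hpde x
  simp only [hpt] at hadj
  have hIfg := integrable_mul_mul_gibbsDensity hω hl hβ γ L hT hf2 hg2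
  have hIfk := integrable_mul_mul_gibbsDensity hω hl hβ γ L hT hf2 hk2
  have e1 : (fun x => f x * ((κ * g x - k x) * (pinnedChain ω₂ lam β γ).gibbsDensity L T x)) =
      fun x => κ * (f x * g x * (pinnedChain ω₂ lam β γ).gibbsDensity L T x) -
        f x * k x * (pinnedChain ω₂ lam β γ).gibbsDensity L T x := by
    funext x; ring
  rw [e1, integral_sub (hIfg.const_mul κ) hIfk, integral_const_mul] at hadj
  rw [(pinnedChain ω₂ lam β γ).integral_gibbsMeasure, (pinnedChain ω₂ lam β γ).integral_gibbsMeasure,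
    (pinnedChain ω₂ lam β γ).integral_gibbsMeasure (fun x => f x * k x)]
  have e2 : (fun x => (-σ * liouvilleOp (pinnedChain ω₂ lam β γ) L f x + c * bathOp L B T f x + 0 * f x) * g x *
      (pinnedChain ω₂ lam β γ).gibbsDensity L T x) =
      fun x => (-σ * liouvilleOp (pinnedChain ω₂ lam β γ) L f x + c * bathOp L B T f x + 0 * f x) *
        (g x * (pinnedChain ω₂ lam β γ).gibbsDensity L T x) := by
    funext x; ring
  rw [e2, hadj]
  ring

/-- **Density of `ℝ·1 + (−σ X_H + c S_B)(C_c^∞)` in `L²(μ_T)`** (pinned chain, `B ≥ 0` with `B_0 > 0`, `σ ≠ 0`,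
`c > 0`): an `L²(μ_T)` function of mean zero that is `μ_T`-orthogonal to every `−σ X_H φ + c S_B φ`, `φ ∈ C_c^∞`,
vanishes a.e. (Hypoelliptic regularity of the weak equation `(σ X_H + c S_B) v = 0`, landed
`exists_classical_of_weak_gibbs`, then the landed `L²(μ_T)`-Liouville theorem.) -/
theorem ae_eq_zero_of_orthogonal_adjointRange (hω : 0 < ω₂) (hl : 0 ≤ lam) (hβ : 0 ≤ β) (γ : ℝ) {L : ℕ}
    (hL : 0 < L) {T : ℝ} (hT : 0 < T) {σ c : ℝ} (hσ : σ ≠ 0) (hc : 0 < c) {B : Fin L → ℝ}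
    (hB : ∀ i, 0 ≤ B i) (hB0 : 0 < B ⟨0, hL⟩) {v : PhaseSpace L → ℝ}
    (hv : MemLp v 2 ((pinnedChain ω₂ lam β γ).gibbsMeasure L T))
    (hmean : ∫ x, v x ∂((pinnedChain ω₂ lam β γ).gibbsMeasure L T) = 0)
    (horth : ∀ φ : PhaseSpace L → ℝ, ContDiff ℝ ∞ φ → HasCompactSupport φ →
      ∫ x, (-σ * liouvilleOp (pinnedChain ω₂ lam β γ) L φ x + c * bathOp L B T φ x + 0 * φ x) * v x
        ∂((pinnedChain ω₂ lam β γ).gibbsMeasure L T) = 0) :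
    v =ᵐ[(pinnedChain ω₂ lam β γ).gibbsMeasure L T] 0 := by
  haveI : IsProbabilityMeasure ((pinnedChain ω₂ lam β γ).gibbsMeasure L T) :=
    pinnedChain_isProbabilityMeasure_gibbsMeasure hω hl hβ γ L hT
  have hweak : ∀ φ : PhaseSpace L → ℝ, ContDiff ℝ ∞ φ → HasCompactSupport φ →
      ∫ x, (-σ * liouvilleOp (pinnedChain ω₂ lam β γ) L φ x + c * bathOp L B T φ x + 0 * φ x) * v x
          ∂((pinnedChain ω₂ lam β γ).gibbsMeasure L T) =
        ∫ x, (fun _ => (0 : ℝ)) x * φ x ∂((pinnedChain ω₂ lam β γ).gibbsMeasure L T) := by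
    intro φ hφ hφc
    rw [horth φ hφ hφc]
    simp
  obtain ⟨v', hv'C, hae, hpde⟩ := exists_classical_of_weak_gibbs hω hl hβ γ hL hT hσ hc hB hB0 0
    (hv.integrable one_le_two) contDiff_const hweak
  have hv'2 : MemLp v' 2 ((pinnedChain ω₂ lam β γ).gibbsMeasure L T) := hv.ae_eq hae
  have hmean' : ∫ x, v' x ∂((pinnedChain ω₂ lam β γ).gibbsMeasure L T) = 0 := by
    rw [← integral_congr_ae hae]
    exact hmean
  have hpde' : ∀ x, σ * liouvilleOp (pinnedChain ω₂ lam β γ) L v' x + c * bathOp L B T v' x = 0 := by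
    intro x
    have e := hpde x
    simpa using e
  have hzero : ∀ x, v' x = 0 := eq_zero_of_liouville_pinnedChain hω hl hβ γ hL hT B hB hB0 hσ hc
    (hv'C.of_le (by norm_cast)) hv'2 hpde' hmean'
  exact hae.trans (ae_of_all _ fun x => by simp [hzero x])

end General

/-! ## The weak Abelian limit -/

section Main

variable {ω₂ lam β γ : ℝ}

/-- **HELPER (A) — weak Abelian limit of the device's κ-resolvent fields** (registered helper of stub
`stub_kuboFrame`, line `thermalise-then-cut-probe-insertion`). For the γ-probed device of `pinnedChain ω₂ lam β γ` at
temperature `T` (`N, M ≥ 2`, site `s < N + M`) and any family `g_κ ∈ C² ∩ L²(μ_T)` (`κ > 0`) of classical solutions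
of `κ g_κ − L_dev g_κ = p_s² − T`: `κ ∫ g_κ φ dμ_T → 0` as `κ → 0⁺` for every `φ ∈ L²(μ_T)`. -/
theorem helper_resolventWeakAbelian :
    ∀ (ω₂ lam β γ T : ℝ), 0 < ω₂ → 0 < lam → 0 < β → 0 < γ → 0 < T →
      ∀ (N M : ℕ), 2 ≤ N → 2 ≤ M → ∀ (s : ℕ), s < N + M →
      ∀ (g : ℝ → PhaseSpace (N + M) → ℝ),
        (∀ κ : ℝ, 0 < κ → ContDiff ℝ 2 (g κ) ∧
          MemLp (g κ) 2 ((pinnedChain ω₂ lam β γ).gibbsMeasure (N + M) T) ∧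
          ∀ x, κ * g κ x - deviceGenerator (pinnedChain ω₂ lam β γ) N M (fun _ => T) (g κ) x =
            kin (N + M) s x - T) →
      ∀ (φ : PhaseSpace (N + M) → ℝ), MemLp φ 2 ((pinnedChain ω₂ lam β γ).gibbsMeasure (N + M) T) →
        Tendsto (fun κ : ℝ => κ * ∫ x, g κ x * φ x ∂((pinnedChain ω₂ lam β γ).gibbsMeasure (N + M) T))
          (𝓝[>] 0) (𝓝 0) := by
  intro ω₂ lam β γ T hω hl hβ hγ hT N M hN hM s hs g hg φ hφ
  -- the setting
  set P := pinnedChain ω₂ lam β γ with hP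
  have hL : 0 < N + M := by omega
  haveI : IsProbabilityMeasure (P.gibbsMeasure (N + M) T) :=
    pinnedChain_isProbabilityMeasure_gibbsMeasure hω hl.le hβ.le γ (N + M) hT
  have hU1 : ContDiff ℝ 1 P.U := pinnedChain_contDiff_U ω₂ lam β γ
  have hV1 : ContDiff ℝ 1 P.V := pinnedChain_contDiff_V ω₂ lam β γ
  have hB : ∀ i, 0 ≤ deviceWeight N M i := fun i => by
    unfold DeviceLiouville.deviceWeight OscillatorChain.bathWeight; split_ifs <;> norm_num
  have hB0 : 0 < deviceWeight N M ⟨0, hL⟩ := by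
    unfold DeviceLiouville.deviceWeight OscillatorChain.bathWeight; simp only [if_true]; split_ifs <;> norm_num
  -- the resolvent family (κ > 0)
  have hC2 : ∀ κ, 0 < κ → ContDiff ℝ 2 (g κ) := fun κ hκ => (hg κ hκ).1
  have hL2 : ∀ κ, 0 < κ → MemLp (g κ) 2 (P.gibbsMeasure (N + M) T) := fun κ hκ => (hg κ hκ).2.1
  have hk2 : MemLp (fun y : PhaseSpace (N + M) => y.2 ⟨s, hs⟩ ^ 2 - T) 2 (P.gibbsMeasure (N + M) T) :=
    memLp_kinetic hω hl.le hβ.le (N + M) hT ⟨s, hs⟩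
  have hpair : ∀ κ, 0 < κ → ∀ x, 1 * liouvilleOp P (N + M) (g κ) x +
      γ * bathOp (N + M) (deviceWeight N M) T (g κ) x = -((x.2 ⟨s, hs⟩ ^ 2 - T) - κ * g κ x) := by
    intro κ hκ x
    have e := (hg κ hκ).2.2 x
    rw [show deviceGenerator P N M (fun _ => T) (g κ) x =
        DeviceLiouville.deviceGenerator P N M (fun _ => T) (g κ) x from rfl, deviceGenerator_eq,
      show kin (N + M) s x = DeviceLiouville.kin (N + M) s x from rfl, kin_eq_sq hs] at e
    rw [show P.γ = γ from rfl] at e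
    linarith
  -- (1) the uniform bound (helper (B))
  have hbound : ∀ κ, 0 < κ → κ ^ 2 * ∫ x, g κ x ^ 2 ∂(P.gibbsMeasure (N + M) T) ≤ 2 * T ^ 2 :=
    fun κ hκ => helper_resolventUniformBound ω₂ lam β γ T hω hl hβ hγ hT N M hN hM s hs κ hκ (g κ)
      (hC2 κ hκ) (hL2 κ hκ) (hg κ hκ).2.2
  -- (2) the mean: ∫ g_κ dμ_T = 0
  have hmean : ∀ κ, 0 < κ → ∫ x, g κ x ∂(P.gibbsMeasure (N + M) T) = 0 := by
    intro κ hκ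
    have h := integral_resolvent_mul_gibbsDensity hω hl.le hβ.le (N + M) hT (deviceWeight N M) hB 1 hγ κ
      (hC2 κ hκ) (hL2 κ hκ) hk2 (hpair κ hκ)
    rw [integral_kinetic_mul_gibbsDensity (γ := γ) hω hl.le hβ.le (N + M) hT ⟨s, hs⟩] at h
    rw [P.integral_gibbsMeasure, (mul_eq_zero.1 h).resolve_left hκ.ne', mul_zero]
  -- the Hilbert space `L²(μ_T)`, the classes `W κ = [κ g_κ]`, the constant `1`
  have hW : ∀ κ (hκ : 0 < κ) (ψ : PhaseSpace (N + M) → ℝ) (hψ : MemLp ψ 2 (P.gibbsMeasure (N + M) T)),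
      ⟪κ • (hL2 κ hκ).toLp (g κ), hψ.toLp ψ⟫_ℝ = κ * ∫ x, g κ x * ψ x ∂(P.gibbsMeasure (N + M) T) := by
    intro κ hκ ψ hψ
    rw [real_inner_smul_left, inner_toLp_toLp]
  set C₀ : ℝ := Real.sqrt (2 * T ^ 2) with hC₀
  have hC₀nn : 0 ≤ C₀ := Real.sqrt_nonneg _
  have hWnorm : ∀ κ (hκ : 0 < κ), ‖κ • (hL2 κ hκ).toLp (g κ)‖ ≤ C₀ := by
    intro κ hκ
    have h1 : ‖κ • (hL2 κ hκ).toLp (g κ)‖ ^ 2 ≤ 2 * T ^ 2 := by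
      rw [norm_smul, mul_pow, Real.norm_eq_abs, sq_abs, norm_toLp_sq]
      exact hbound κ hκ
    simpa only [abs_of_nonneg (norm_nonneg _)] using Real.abs_le_sqrt h1
  -- the family as a function on `ℝ` (zero for `κ ≤ 0`)
  set W : ℝ → Lp ℝ 2 (P.gibbsMeasure (N + M) T) := fun κ =>
    if h : 0 < κ then κ • (hL2 κ h).toLp (g κ) else 0 with hWdef
  have hWpos : ∀ κ (hκ : 0 < κ), W κ = κ • (hL2 κ hκ).toLp (g κ) := fun κ hκ => by
    simp only [hWdef, dif_pos hκ]
  have hWnorm' : ∀ κ, ‖W κ‖ ≤ C₀ := fun κ => by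
    by_cases hκ : 0 < κ
    · rw [hWpos κ hκ]; exact hWnorm κ hκ
    · simp only [hWdef, dif_neg hκ, norm_zero]; exact hC₀nn
  have hev : ∀ᶠ κ in 𝓝[>] (0 : ℝ), 0 < κ := eventually_mem_nhdsWithin
  -- (3) convergence on the generating set: constants …
  have h1mem : MemLp (fun _ : PhaseSpace (N + M) => (1 : ℝ)) 2 (P.gibbsMeasure (N + M) T) := memLp_const 1
  have hOne : Tendsto (fun κ => ⟪W κ, h1mem.toLp _⟫_ℝ) (𝓝[>] 0) (𝓝 0) := by
    refine (tendsto_const_nhds (x := (0 : ℝ))).congr' ?_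
    filter_upwards [hev] with κ hκ
    rw [hWpos κ hκ, hW κ hκ _ h1mem]
    simp [hmean κ hκ]
  -- … and the adjoint range
  have hNmem : ∀ (f : PhaseSpace (N + M) → ℝ), ContDiff ℝ ∞ f → HasCompactSupport f →
      MemLp (fun x => (-1) * liouvilleOp P (N + M) f x + γ * bathOp (N + M) (deviceWeight N M) T f x + 0 * f x)
        2 (P.gibbsMeasure (N + M) T) := fun f hf hfc =>
    memLp_two_of_hasCompactSupport _ (continuous_genOp hU1 hV1 (N + M) (-1) γ 0 (deviceWeight N M) T
      (hf.of_le (by norm_cast)))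
      (hasCompactSupport_genOp (N + M) (-1) γ 0 (deviceWeight N M) T (hf.of_le (by norm_cast)) hfc)
  have hRange : ∀ (f : PhaseSpace (N + M) → ℝ) (hf : ContDiff ℝ ∞ f) (hfc : HasCompactSupport f),
      Tendsto (fun κ => ⟪W κ, (hNmem f hf hfc).toLp _⟫_ℝ) (𝓝[>] 0) (𝓝 0) := by
    intro f hf hfc
    have hf2 : ContDiff ℝ 2 f := hf.of_le (by norm_cast)
    have hfL2 : MemLp f 2 (P.gibbsMeasure (N + M) T) := memLp_two_of_hasCompactSupport _ hf.continuous hfc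
    -- for κ > 0: ⟪W κ, [L^† f]⟫ = κ ⟪W κ, [f]⟫ − κ ∫ f k dμ
    have hformula : ∀ᶠ κ in 𝓝[>] (0 : ℝ), ⟪W κ, (hNmem f hf hfc).toLp _⟫_ℝ =
        κ * ⟪W κ, hfL2.toLp f⟫_ℝ -
          κ * ∫ x, f x * (x.2 ⟨s, hs⟩ ^ 2 - T) ∂(P.gibbsMeasure (N + M) T) := by
      filter_upwards [hev] with κ hκ
      rw [hWpos κ hκ, hW κ hκ _ (hNmem f hf hfc), hW κ hκ _ hfL2]
      have hadj := integral_adjointOp_mul_resolvent hω hl.le hβ.le (N + M) hT (deviceWeight N M) 1 γ κ hf2 hfc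
        (hC2 κ hκ) (hL2 κ hκ) hk2 (hpair κ hκ)
      have e1 : ∫ x, g κ x * ((-1) * liouvilleOp P (N + M) f x + γ * bathOp (N + M) (deviceWeight N M) T f x +
          0 * f x) ∂(P.gibbsMeasure (N + M) T) =
          ∫ x, (-1 * liouvilleOp P (N + M) f x + γ * bathOp (N + M) (deviceWeight N M) T f x + 0 * f x) *
            g κ x ∂(P.gibbsMeasure (N + M) T) :=
        integral_congr_ae (ae_of_all _ fun x => by ring)
      have e2 : ∫ x, f x * g κ x ∂(P.gibbsMeasure (N + M) T) = ∫ x, g κ x * f x ∂(P.gibbsMeasure (N + M) T) :=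
        integral_congr_ae (ae_of_all _ fun x => by ring)
      rw [e1, hadj, e2]
      ring
    have hlim1 : Tendsto (fun κ : ℝ => κ * ⟪W κ, hfL2.toLp f⟫_ℝ) (𝓝[>] 0) (𝓝 0) := by
      refine squeeze_zero_norm' (a := fun κ : ℝ => |κ| * (C₀ * ‖hfL2.toLp f‖)) ?_ ?_
      · filter_upwards with κ
        rw [Real.norm_eq_abs, abs_mul]
        refine mul_le_mul_of_nonneg_left ?_ (abs_nonneg κ)
        exact (abs_real_inner_le_norm _ _).trans (mul_le_mul_of_nonneg_right (hWnorm' κ) (norm_nonneg _))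
      · refine tendsto_nhdsWithin_of_tendsto_nhds ?_
        simpa using ((continuous_abs.tendsto (0 : ℝ)).mul_const (C₀ * ‖hfL2.toLp f‖))
    have hlim2 : Tendsto (fun κ : ℝ => κ * ∫ x, f x * (x.2 ⟨s, hs⟩ ^ 2 - T) ∂(P.gibbsMeasure (N + M) T))
        (𝓝[>] 0) (𝓝 0) := by
      refine tendsto_nhdsWithin_of_tendsto_nhds ?_
      simpa using (tendsto_id (x := 𝓝 (0 : ℝ))).mul_const (∫ x, f x * (x.2 ⟨s, hs⟩ ^ 2 - T) ∂(P.gibbsMeasure (N + M) T))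
    simpa using (hlim1.sub hlim2).congr' (hformula.mono fun κ hκ => hκ.symm)
  -- (4) the dense subspace `D = span(1, L^†(C_c^∞))` and convergence on it
  set S : Set (Lp ℝ 2 (P.gibbsMeasure (N + M) T)) :=
    insert (h1mem.toLp _) {u | ∃ (f : PhaseSpace (N + M) → ℝ) (hf : ContDiff ℝ ∞ f)
      (hfc : HasCompactSupport f), u = (hNmem f hf hfc).toLp _} with hSdef
  have hS : ∀ u ∈ S, Tendsto (fun κ => ⟪W κ, u⟫_ℝ) (𝓝[>] 0) (𝓝 0) := by
    intro u hu
    rcases hu with rfl | ⟨f, hf, hfc, rfl⟩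
    · exact hOne
    · exact hRange f hf hfc
  have hspan : ∀ u ∈ Submodule.span ℝ S, Tendsto (fun κ => ⟪W κ, u⟫_ℝ) (𝓝[>] 0) (𝓝 0) := by
    intro u hu
    refine Submodule.span_induction (p := fun u _ => Tendsto (fun κ => ⟪W κ, u⟫_ℝ) (𝓝[>] 0) (𝓝 0))
      (fun u hu => hS u hu) ?_ ?_ ?_ hu
    · exact (tendsto_const_nhds (x := (0 : ℝ))).congr fun κ => (inner_zero_right (W κ)).symm
    · intro u v _ _ hu hv
      simpa [inner_add_right] using hu.add hv
    · intro a u _ hu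
      simpa [real_inner_smul_right] using hu.const_mul a
  -- density: the orthogonal complement of `span S` is trivial
  have hDorth : (Submodule.span ℝ S)ᗮ = ⊥ := by
    rw [Submodule.eq_bot_iff]
    intro v hv
    have h1 : ⟪h1mem.toLp _, v⟫_ℝ = 0 :=
      Submodule.inner_right_of_mem_orthogonal (Submodule.subset_span (Set.mem_insert _ _)) hv
    have h2 : ∀ (f : PhaseSpace (N + M) → ℝ) (hf : ContDiff ℝ ∞ f) (hfc : HasCompactSupport f),
        ⟪(hNmem f hf hfc).toLp _, v⟫_ℝ = 0 := by
      intro f hf hfc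
      have hmemS : (hNmem f hf hfc).toLp _ ∈ S := by
        rw [hSdef]
        exact Set.mem_insert_of_mem _ ⟨f, hf, hfc, rfl⟩
      exact Submodule.inner_right_of_mem_orthogonal (Submodule.subset_span hmemS) hv
    rw [inner_toLp_left] at h1
    simp only [one_mul] at h1
    have horth : ∀ φ' : PhaseSpace (N + M) → ℝ, ContDiff ℝ ∞ φ' → HasCompactSupport φ' →
        ∫ x, (-1 * liouvilleOp P (N + M) φ' x + γ * bathOp (N + M) (deviceWeight N M) T φ' x + 0 * φ' x) * v x
          ∂(P.gibbsMeasure (N + M) T) = 0 := by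
      intro φ' hφ' hφ'c
      have e := h2 φ' hφ' hφ'c
      rw [inner_toLp_left] at e
      exact e
    have hae := ae_eq_zero_of_orthogonal_adjointRange hω hl.le hβ.le γ hL hT one_ne_zero hγ hB hB0
      (Lp.memLp v) h1 horth
    exact Lp.eq_zero_iff_ae_eq_zero.2 hae
  have hdense : (Submodule.span ℝ S).topologicalClosure = ⊤ :=
    Submodule.topologicalClosure_eq_top_iff.2 hDorth
  -- (5) ε/2: bounded family + convergence on a dense subspace
  have hΦcl : hφ.toLp φ ∈ closure ((Submodule.span ℝ S : Submodule ℝ (Lp ℝ 2 (P.gibbsMeasure (N + M) T))) :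
      Set (Lp ℝ 2 (P.gibbsMeasure (N + M) T))) := by
    rw [← Submodule.topologicalClosure_coe, hdense]
    trivial
  have hmain : Tendsto (fun κ => ⟪W κ, hφ.toLp φ⟫_ℝ) (𝓝[>] 0) (𝓝 0) := by
    rw [Metric.tendsto_nhds]
    intro ε hε
    have hδ : 0 < ε / (2 * (C₀ + 1)) := by positivity
    obtain ⟨ψ, hψS, hψd⟩ := Metric.mem_closure_iff.1 hΦcl _ hδ
    have hψlim := Metric.tendsto_nhds.1 (hspan ψ hψS) (ε / 2) (by positivity)
    filter_upwards [hψlim] with κ hκ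
    rw [Real.dist_0_eq_abs] at hκ ⊢
    have hsplit : ⟪W κ, hφ.toLp φ⟫_ℝ = ⟪W κ, ψ⟫_ℝ + ⟪W κ, hφ.toLp φ - ψ⟫_ℝ := by
      rw [inner_sub_right]; ring
    rw [hsplit]
    have hb : |⟪W κ, hφ.toLp φ - ψ⟫_ℝ| ≤ C₀ * (ε / (2 * (C₀ + 1))) := by
      refine (abs_real_inner_le_norm _ _).trans ?_
      refine mul_le_mul (hWnorm' κ) ?_ (norm_nonneg _) hC₀nn
      rw [← dist_eq_norm]
      exact hψd.le
    have hc : C₀ * (ε / (2 * (C₀ + 1))) < ε / 2 := by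
      rw [show C₀ * (ε / (2 * (C₀ + 1))) = (ε / 2) * (C₀ / (C₀ + 1)) by field_simp]
      have : C₀ / (C₀ + 1) < 1 := by
        rw [div_lt_one (by positivity)]; linarith
      nlinarith
    calc |⟪W κ, ψ⟫_ℝ + ⟪W κ, hφ.toLp φ - ψ⟫_ℝ|
        ≤ |⟪W κ, ψ⟫_ℝ| + |⟪W κ, hφ.toLp φ - ψ⟫_ℝ| := abs_add_le _ _
      _ < ε / 2 + ε / 2 := add_lt_add_of_lt_of_le hκ (hb.trans hc.le)
      _ = ε := by ring
  -- back to the statement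
  refine hmain.congr' ?_
  filter_upwards [hev] with κ hκ
  rw [hWpos κ hκ, hW κ hκ φ hφ]

end Main

end Summit.AtomisticToContinuum.FouriersLaw.Cruxes.SuperadditiveResistance.ThermaliseThenCutProbeInsertion

end
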